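import Literature.MathematicalPhysics.QuantumLattice.TwistEaterIrreducibility
import Literature.Analysis.Fourier.DiscreteWirtingerInequality
import Mathlib.Algebra.Order.Chebyshev
import HarnessLib

/-!
# The adjoint Laplacian of the `ℓ × ℓ` twisted torus has no zero mode on `su(N)`:
# Poincaré inequalities with the elementary constant `4 sin²(π/N) / ℓ²` and the sharp one `4 sin²(π/(Nℓ))`
# (twist-eating boundary conditions, any `ℓ ≥ 1`)

Topic `Literature/MathematicalPhysics/QuantumLattice`; sequel of `TwistEaterIrreducibility.lean` (§6 there: the one-site
colour-momentum gap `twistedLaplacian_gap` — for a unitary Weyl pair `A B = ω·B A`, `ω` primitive, and traceless `Φ`,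
`‖AΦAᴴ − Φ‖²_HS + ‖BΦBᴴ − Φ‖²_HS ≥ 4 sin²(π/N)·‖Φ‖²_HS`).

García Pérez–González-Arroyo–Okawa, IJMPA 29 (2014) 1445001, §3 (corpus `paper:arxiv-1406.5655` p0006 L1–L22): in the twisted
box the adjoint fields expand in the basis `Γ̂(p)` with «momentum quantized in units of `2π/(N̂ l_μ)` … the prime in the sum
restricts the allowed set of momenta, excluding those with `m_μ = 0 (mod L) ∀μ`.  This ensures that the `A_μ` field is traceless
and naturally provides an infrared cut-off to the theory» — the fluctuation operator around a twist-eating background has NO ZERO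
MODE on the traceless fields, with lowest momentum `≍ 2π/(N ℓ)` (González-Arroyo–Korthals Altes 1983; 't Hooft 1981; contrast the
periodic box, Lüscher 1983, where the constant modes are zero modes).  This file proves the lattice statement behind it for the
two twisted directions of a twist-eating `SU(N)`-type background (transition functions acting on adjoint fields by the constant
conjugations `Ad A`, `Ad B` of a unitary Weyl pair), in the form of discrete POINCARÉ INEQUALITIES: §1–§3 with an explicit,
slightly weaker than sharp, constant — elementary proof (telescoping + Cauchy–Schwarz + the one-site gap), no Fourier analysis;
§4 with the SHARP constant `4 sin²(π/(Nℓ))` — Bloch–Fourier decomposition in the 't Hooft basis (colour momentum) and the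
periodic discrete Wirtinger inequality of `Literature/Analysis/Fourier/DiscreteWirtingerInequality.lean`:

* Hilbert–Schmidt energy `S(X) = Re tr(XᴴX) = Σ_{ij} |X_{ij}|²`: `re_trace_conjTranspose_mul_self_eq_sum`, `_nonneg`,
  `re_trace_conjTranspose_mul_self_conj` (invariance under `X ↦ U X Uᴴ`, `UᴴU = 1`), `re_trace_conjTranspose_mul_self_sum_le`
  (`S(Σ_{j<ℓ} d_j) ≤ ℓ Σ_j S(d_j)`);
* ★ `twistedPeriodic_poincare_1d` — for a sequence `G : ℕ → M_N(ℂ)` with TWISTED PERIODICITY `G(s + ℓ) = U G(s) Uᴴ`: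
  `Σ_{s<ℓ} S(U G(s) Uᴴ − G(s)) ≤ ℓ² Σ_{s<ℓ} S(G(s+1) − G(s))` (the twist acting on a site is a sum of `ℓ` nearest-neighbour
  differences around the circle);
* ★★ `twistedTorus_poincare` — for `Φ : ℕ → ℕ → M_N(ℂ)` with `Φ(x+ℓ, y) = A Φ(x,y) Aᴴ`, `Φ(x, y+ℓ) = B Φ(x,y) Bᴴ` (unitary Weyl pair,
  `ω` primitive) and `tr Φ(x,y) = 0`:
  `4 sin²(π/N) · Σ_{x,y<ℓ} S(Φ(x,y)) ≤ ℓ² · Σ_{x,y<ℓ} [S(Φ(x+1,y) − Φ(x,y)) + S(Φ(x,y+1) − Φ(x,y))]` —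
  the nearest-neighbour (adjoint, twisted) Dirichlet form dominates `(2 sin(π/N)/ℓ)² ≥ (4/(Nℓ))²` times the mass: no zero mode,
  tree-level gap of order `1/(Nℓ)²`, uniform in everything else (further periodic directions only ADD non-negative terms);
  `twistedTorus_poincare_sixteen` (the floor `16 Σ S(Φ) ≤ (Nℓ)² Σ[…]`, `N ≥ 2`).
* §4 (sharp constant): `colourMomentum_poincare_sharp` — one colour-momentum component `(a, b) ≠ (0, 0)` of the adjoint field,
  i.e. a scalar `g : ℕ² → ℂ` with `g(x+ℓ, y) = ω^b g(x,y)`, `g(x, y+ℓ) = ω^{−a} g(x,y)`: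
  `4 sin²(π/(Nℓ)) · Σ_{x,y<ℓ} |g|² ≤ Σ_{x,y<ℓ} (|∂₀g|² + |∂₁g|²)` (momenta `2π(Nn_μ + r_μ)/(Nℓ)` with `(r₀, r₁) = (b, −a) ≠ 0`);
  ★★★ `twistedTorus_poincare_sharp` — for twisted-periodic TRACELESS `Φ` as above,
  `4 sin²(π/(Nℓ)) · Σ_{x,y<ℓ} S(Φ(x,y)) ≤ Σ_{x,y<ℓ} [S(Φ(x+1,y) − Φ(x,y)) + S(Φ(x,y+1) − Φ(x,y))]`: the twisted adjoint Laplacian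
  of the `ℓ × ℓ` torus has gap EXACTLY the square of the smallest twisted momentum `2 sin(π/(Nℓ))` on `su(N)` (attained by a
  single plane wave in the component `(a, b) = (0, 1)`), uniform in nothing else.  This resolves the former TODO(general form)
  of this file (the §3 constant `4 sin²(π/N)/ℓ²` has the same order but is not sharp).
  `twistedTube_poincare_sharp` ∕ `_four` — the four-index tube `ℓ × ℓ × L₂ × L₃` (twisted in `x₀, x₁`, nothing assumed in
  `x₂, x₃`): the same constant `4 sin²(π/(Nℓ))`, UNIFORM in `L₂, L₃` (slice by slice; longitudinal differences only add
  non-negative terms).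

HONEST FRAMING: a statement about the quadratic (tree-level) fluctuation form of ONE twisted box at fixed lattice spacing; nothing
on interacting corrections, uniformity in `β`, purity, IR ∕ IRcof, or the Yang–Mills mass gap (Clay), which is NOT proved; `R4` closes
only `BalabanLadder.UV`.

References: M. García Pérez, A. González-Arroyo, M. Okawa, IJMPA 29 (2014) 1445001 = arXiv:1406.5655, §3; A. González-Arroyo,
hep-th/9807108, §4.3; A. González-Arroyo, C. P. Korthals Altes, Nucl. Phys. B 311 (1988) 433 (twisted-box spectrum); G. 't Hooft,
Commun. Math. Phys. 81 (1981) 267; for the discrete Wirtinger inequality: K. Fan, O. Taussky, J. Todd, Monatsh. Math. 59 (1955)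
73–90; R. P. Agarwal, *Difference Equations and Inequalities* (1992), Thm 11.6.3.
-/

noncomputable section

open scoped Matrix
open Finset

namespace Literature.MathematicalPhysics.QuantumLattice

variable {N : ℕ}

/-! ## §1 The Hilbert–Schmidt energy `Re tr(XᴴX)` -/

section HS

/-- `Re tr(XᴴX) = Σ_{i,j} |X_{ij}|²` (the Hilbert–Schmidt ∕ Frobenius norm squared). [cite: GarciaperezGonzalezarroyoOkawa2014, §3] -/
theorem re_trace_conjTranspose_mul_self_eq_sum (X : Matrix (Fin N) (Fin N) ℂ) :
    ((Xᴴ * X).trace).re = ∑ i, ∑ j, ‖X i j‖ ^ 2 := by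
  rw [Matrix.trace, Complex.re_sum, Finset.sum_comm]
  refine Finset.sum_congr rfl fun j _ => ?_
  rw [Matrix.diag_apply, Matrix.mul_apply, Complex.re_sum]
  refine Finset.sum_congr rfl fun i _ => ?_
  rw [Matrix.conjTranspose_apply, Complex.star_def, Complex.conj_mul', ← Complex.ofReal_pow, Complex.ofReal_re]

/-- `Re tr(XᴴX) ≥ 0`. [cite: GarciaperezGonzalezarroyoOkawa2014, §3] -/
theorem re_trace_conjTranspose_mul_self_nonneg (X : Matrix (Fin N) (Fin N) ℂ) : 0 ≤ ((Xᴴ * X).trace).re := by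
  rw [re_trace_conjTranspose_mul_self_eq_sum]
  positivity

/-- Invariance under unitary conjugation: `Re tr((UXUᴴ)ᴴ(UXUᴴ)) = Re tr(XᴴX)` for `UᴴU = 1` (the transition functions of the
twisted box act isometrically on the adjoint fields). [cite: GarciaperezGonzalezarroyoOkawa2014, §3] -/
theorem re_trace_conjTranspose_mul_self_conj {U : Matrix (Fin N) (Fin N) ℂ} (hU : Uᴴ * U = 1)
    (X : Matrix (Fin N) (Fin N) ℂ) :
    (((U * X * Uᴴ)ᴴ * (U * X * Uᴴ)).trace).re = ((Xᴴ * X).trace).re := by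
  have hm : (U * X * Uᴴ)ᴴ * (U * X * Uᴴ) = U * (Xᴴ * X * Uᴴ) := by
    rw [Matrix.conjTranspose_mul, Matrix.conjTranspose_mul, Matrix.conjTranspose_conjTranspose]
    calc U * (Xᴴ * Uᴴ) * (U * X * Uᴴ) = U * (Xᴴ * (Uᴴ * U) * X) * Uᴴ := by simp only [Matrix.mul_assoc]
      _ = U * (Xᴴ * X) * Uᴴ := by rw [hU, Matrix.mul_one]
      _ = U * (Xᴴ * X * Uᴴ) := by rw [Matrix.mul_assoc]
  rw [hm, Matrix.trace_mul_comm, Matrix.mul_assoc, hU, Matrix.mul_one]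

/-- **Cauchy–Schwarz for the energy of a sum**: `Re tr((Σ_{j<ℓ} d_j)ᴴ(Σ_{j<ℓ} d_j)) ≤ ℓ · Σ_{j<ℓ} Re tr(d_jᴴ d_j)`.
[cite: GarciaperezGonzalezarroyoOkawa2014, §3] -/
theorem re_trace_conjTranspose_mul_self_sum_le (ℓ : ℕ) (d : ℕ → Matrix (Fin N) (Fin N) ℂ) :
    (((∑ j ∈ range ℓ, d j)ᴴ * (∑ j ∈ range ℓ, d j)).trace).re ≤
      (ℓ : ℝ) * ∑ j ∈ range ℓ, ((( d j)ᴴ * d j).trace).re := by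
  simp_rw [re_trace_conjTranspose_mul_self_eq_sum]
  rw [Finset.mul_sum]
  -- reorder the right-hand side to `Σ_i Σ_j ℓ · Σ_k |d_k i j|²`
  have hr : ∑ k ∈ range ℓ, ∑ i : Fin N, ∑ j : Fin N, ‖d k i j‖ ^ 2 =
      ∑ i : Fin N, ∑ j : Fin N, ∑ k ∈ range ℓ, ‖d k i j‖ ^ 2 := by
    rw [Finset.sum_comm]
    refine Finset.sum_congr rfl fun i _ => ?_
    rw [Finset.sum_comm]
  rw [← Finset.mul_sum, hr, Finset.mul_sum]
  refine Finset.sum_le_sum fun i _ => ?_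
  rw [Finset.mul_sum]
  refine Finset.sum_le_sum fun j _ => ?_
  -- entrywise: `|Σ_k d_k i j|² ≤ (Σ_k |d_k i j|)² ≤ ℓ Σ_k |d_k i j|²`
  rw [Matrix.sum_apply]
  calc ‖∑ k ∈ range ℓ, d k i j‖ ^ 2 ≤ (∑ k ∈ range ℓ, ‖d k i j‖) ^ 2 := by
        gcongr
        exact norm_sum_le _ _
    _ ≤ (#(range ℓ) : ℝ) * ∑ k ∈ range ℓ, ‖d k i j‖ ^ 2 := sq_sum_le_card_mul_sum_sq
    _ = (ℓ : ℝ) * ∑ k ∈ range ℓ, ‖d k i j‖ ^ 2 := by rw [Finset.card_range]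

end HS

/-! ## §2 One twisted direction: the twist at a site is `ℓ` nearest-neighbour differences around the circle -/

section OneD

/-- Sums of an `ℓ`-periodic real sequence over any window of length `ℓ` agree. [folklore] -/
private theorem sum_range_add_of_periodic {f : ℕ → ℝ} {ℓ : ℕ} (hf : ∀ u, f (u + ℓ) = f u) (s : ℕ) :
    ∑ j ∈ range ℓ, f (s + j) = ∑ j ∈ range ℓ, f j := by
  induction s with
  | zero => simp
  | succ s ih =>
    have h1 : ∑ j ∈ range ℓ, f (s + 1 + j) = ∑ j ∈ range ℓ, f (s + (j + 1)) :=
      Finset.sum_congr rfl fun j _ => by rw [add_assoc, add_comm 1 j]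
    rw [h1, ← ih]
    rcases Nat.eq_zero_or_pos ℓ with hℓ | hℓ
    · subst hℓ; simp
    · obtain ⟨m, rfl⟩ : ∃ m, ℓ = m + 1 := ⟨ℓ - 1, by omega⟩
      rw [Finset.sum_range_succ (fun j => f (s + (j + 1))) m, Finset.sum_range_succ' (fun j => f (s + j)) m,
        show s + (m + 1) = s + 0 + (m + 1) by ring, hf]

/-- ★ **Twisted-periodic Poincaré inequality in one direction.**  If `G : ℕ → M_N(ℂ)` is twisted-periodic,
`G(s + ℓ) = U G(s) Uᴴ` with `UᴴU = 1`, then the energy of the twist action is controlled by the nearest-neighbour Dirichlet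
form around the circle: `Σ_{s<ℓ} Re tr((UG(s)Uᴴ − G(s))ᴴ(…)) ≤ ℓ² · Σ_{s<ℓ} Re tr((G(s+1) − G(s))ᴴ(G(s+1) − G(s)))`.
Proof: `U G(s) Uᴴ − G(s) = G(s+ℓ) − G(s) = Σ_{j<ℓ} (G(s+j+1) − G(s+j))`, Cauchy–Schwarz, and periodicity of the energy of
the differences. [cite: GarciaperezGonzalezarroyoOkawa2014, §3] -/
theorem twistedPeriodic_poincare_1d {U : Matrix (Fin N) (Fin N) ℂ} (hU : Uᴴ * U = 1) {ℓ : ℕ}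
    {G : ℕ → Matrix (Fin N) (Fin N) ℂ} (hG : ∀ s, G (s + ℓ) = U * G s * Uᴴ) :
    ∑ s ∈ range ℓ, (((U * G s * Uᴴ - G s)ᴴ * (U * G s * Uᴴ - G s)).trace).re ≤
      (ℓ : ℝ) ^ 2 * ∑ s ∈ range ℓ, (((G (s + 1) - G s)ᴴ * (G (s + 1) - G s)).trace).re := by
  -- the energy of the differences is `ℓ`-periodic
  set f : ℕ → ℝ := fun u => (((G (u + 1) - G u)ᴴ * (G (u + 1) - G u)).trace).re with hf
  have hper : ∀ u, f (u + ℓ) = f u := by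
    intro u
    simp only [hf]
    rw [show u + ℓ + 1 = (u + 1) + ℓ by ring, hG, hG, ← Matrix.sub_mul, ← Matrix.mul_sub,
      re_trace_conjTranspose_mul_self_conj hU]
  -- telescoping + Cauchy–Schwarz at each site
  have hsite : ∀ s, (((U * G s * Uᴴ - G s)ᴴ * (U * G s * Uᴴ - G s)).trace).re ≤ (ℓ : ℝ) * ∑ j ∈ range ℓ, f j := by
    intro s
    have htel : ∑ j ∈ range ℓ, (G (s + j + 1) - G (s + j)) = U * G s * Uᴴ - G s := by
      have h := Finset.sum_range_sub (fun j => G (s + j)) ℓ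
      simp only [add_zero] at h
      rw [hG] at h
      simpa only [add_assoc] using h
    rw [← htel, ← sum_range_add_of_periodic hper s]
    exact re_trace_conjTranspose_mul_self_sum_le ℓ (fun j => G (s + j + 1) - G (s + j))
  calc ∑ s ∈ range ℓ, (((U * G s * Uᴴ - G s)ᴴ * (U * G s * Uᴴ - G s)).trace).re
      ≤ ∑ _s ∈ range ℓ, (ℓ : ℝ) * ∑ j ∈ range ℓ, f j := Finset.sum_le_sum fun s _ => hsite s
    _ = (ℓ : ℝ) ^ 2 * ∑ j ∈ range ℓ, f j := by rw [Finset.sum_const, Finset.card_range, nsmul_eq_mul]; ring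

end OneD

/-! ## §3 The `ℓ × ℓ` twisted torus: Poincaré inequality ∕ absence of zero modes on `su(N)` -/

section TwoD

variable [NeZero N] {A B : Matrix (Fin N) (Fin N) ℂ} {ω : ℂ}

/-- ★★ **Poincaré inequality for the adjoint Laplacian of the `ℓ × ℓ` torus with twist-eating boundary conditions.**  For a
unitary Weyl pair `A B = ω·B A` (`ω` a primitive `N`-th root of unity) and an adjoint field `Φ : ℕ² → M_N(ℂ)` which is
twisted-periodic, `Φ(x+ℓ, y) = A Φ(x,y) Aᴴ`, `Φ(x, y+ℓ) = B Φ(x,y) Bᴴ`, and TRACELESS, the nearest-neighbour Dirichlet form over one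
period dominates the mass: `4 sin²(π/N) · Σ_{x,y<ℓ} ‖Φ(x,y)‖²_HS ≤ ℓ² · Σ_{x,y<ℓ} (‖Φ(x+1,y) − Φ(x,y)‖²_HS + ‖Φ(x,y+1) − Φ(x,y)‖²_HS)`.
Equivalently: the twisted adjoint Laplacian has no zero mode on `su(N)` and its gap is at least `(2 sin(π/N)/ℓ)²` («momentum
quantized in units of `2π/(N̂ l_μ)` … excluding `m_μ = 0 (mod L) ∀μ` … provides an infrared cut-off»).  Sharp constant:
`4 sin²(π/(Nℓ))` — `twistedTorus_poincare_sharp` (§4). [cite: GarciaperezGonzalezarroyoOkawa2014, §3] [cite: Gonzalezarroyo1998, §4.3] -/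
theorem twistedTorus_poincare (hAu : A ∈ Matrix.unitaryGroup (Fin N) ℂ) (hBu : B ∈ Matrix.unitaryGroup (Fin N) ℂ)
    (hω : IsPrimitiveRoot ω N) (hAB : A * B = ω • (B * A)) {ℓ : ℕ} {Φ : ℕ → ℕ → Matrix (Fin N) (Fin N) ℂ}
    (h0 : ∀ x y, Φ (x + ℓ) y = A * Φ x y * Aᴴ) (h1 : ∀ x y, Φ x (y + ℓ) = B * Φ x y * Bᴴ)
    (htr : ∀ x y, (Φ x y).trace = 0) :
    4 * Real.sin (Real.pi / N) ^ 2 * ∑ x ∈ range ℓ, ∑ y ∈ range ℓ, (((Φ x y)ᴴ * Φ x y).trace).re ≤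
      (ℓ : ℝ) ^ 2 * ∑ x ∈ range ℓ, ∑ y ∈ range ℓ,
        ((((Φ (x + 1) y - Φ x y)ᴴ * (Φ (x + 1) y - Φ x y)).trace).re +
          (((Φ x (y + 1) - Φ x y)ᴴ * (Φ x (y + 1) - Φ x y)).trace).re) := by
  -- pointwise colour-momentum gap
  have hgap : ∀ x y, 4 * Real.sin (Real.pi / N) ^ 2 * (((Φ x y)ᴴ * Φ x y).trace).re ≤
      (((A * Φ x y * Aᴴ - Φ x y)ᴴ * (A * Φ x y * Aᴴ - Φ x y)).trace).re +
        (((B * Φ x y * Bᴴ - Φ x y)ᴴ * (B * Φ x y * Bᴴ - Φ x y)).trace).re :=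
    fun x y => twistedLaplacian_gap hAu hBu hω hAB (htr x y)
  -- direction 0: for each `y`, the sequence `x ↦ Φ x y` is `Ad A`-twisted periodic
  have hdir0 : ∀ y ∈ range ℓ,
      ∑ x ∈ range ℓ, (((A * Φ x y * Aᴴ - Φ x y)ᴴ * (A * Φ x y * Aᴴ - Φ x y)).trace).re ≤
        (ℓ : ℝ) ^ 2 * ∑ x ∈ range ℓ, (((Φ (x + 1) y - Φ x y)ᴴ * (Φ (x + 1) y - Φ x y)).trace).re :=
    fun y _ => twistedPeriodic_poincare_1d (G := fun x => Φ x y) hAu.1 (fun s => h0 s y)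
  -- direction 1: for each `x`, the sequence `y ↦ Φ x y` is `Ad B`-twisted periodic
  have hdir1 : ∀ x ∈ range ℓ,
      ∑ y ∈ range ℓ, (((B * Φ x y * Bᴴ - Φ x y)ᴴ * (B * Φ x y * Bᴴ - Φ x y)).trace).re ≤
        (ℓ : ℝ) ^ 2 * ∑ y ∈ range ℓ, (((Φ x (y + 1) - Φ x y)ᴴ * (Φ x (y + 1) - Φ x y)).trace).re :=
    fun x _ => twistedPeriodic_poincare_1d (G := fun y => Φ x y) hBu.1 (fun s => h1 x s)
  -- assemble
  calc 4 * Real.sin (Real.pi / N) ^ 2 * ∑ x ∈ range ℓ, ∑ y ∈ range ℓ, (((Φ x y)ᴴ * Φ x y).trace).re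
      = ∑ x ∈ range ℓ, ∑ y ∈ range ℓ, 4 * Real.sin (Real.pi / N) ^ 2 * (((Φ x y)ᴴ * Φ x y).trace).re := by
        rw [Finset.mul_sum]
        refine Finset.sum_congr rfl fun x _ => ?_
        rw [Finset.mul_sum]
    _ ≤ ∑ x ∈ range ℓ, ∑ y ∈ range ℓ,
          ((((A * Φ x y * Aᴴ - Φ x y)ᴴ * (A * Φ x y * Aᴴ - Φ x y)).trace).re +
            (((B * Φ x y * Bᴴ - Φ x y)ᴴ * (B * Φ x y * Bᴴ - Φ x y)).trace).re) :=
        Finset.sum_le_sum fun x _ => Finset.sum_le_sum fun y _ => hgap x y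
    _ = ∑ y ∈ range ℓ, ∑ x ∈ range ℓ, (((A * Φ x y * Aᴴ - Φ x y)ᴴ * (A * Φ x y * Aᴴ - Φ x y)).trace).re +
          ∑ x ∈ range ℓ, ∑ y ∈ range ℓ, (((B * Φ x y * Bᴴ - Φ x y)ᴴ * (B * Φ x y * Bᴴ - Φ x y)).trace).re := by
        simp only [Finset.sum_add_distrib]
        rw [Finset.sum_comm]
    _ ≤ ∑ y ∈ range ℓ, (ℓ : ℝ) ^ 2 * ∑ x ∈ range ℓ, (((Φ (x + 1) y - Φ x y)ᴴ * (Φ (x + 1) y - Φ x y)).trace).re +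
          ∑ x ∈ range ℓ, (ℓ : ℝ) ^ 2 * ∑ y ∈ range ℓ, (((Φ x (y + 1) - Φ x y)ᴴ * (Φ x (y + 1) - Φ x y)).trace).re :=
        add_le_add (Finset.sum_le_sum hdir0) (Finset.sum_le_sum hdir1)
    _ = (ℓ : ℝ) ^ 2 * ∑ x ∈ range ℓ, ∑ y ∈ range ℓ,
          ((((Φ (x + 1) y - Φ x y)ᴴ * (Φ (x + 1) y - Φ x y)).trace).re +
            (((Φ x (y + 1) - Φ x y)ᴴ * (Φ x (y + 1) - Φ x y)).trace).re) := by
        rw [← Finset.mul_sum, ← Finset.mul_sum, ← mul_add]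
        congr 1
        rw [Finset.sum_comm]
        simp only [Finset.sum_add_distrib]

/-- **The explicit floor**: `16 · Σ ‖Φ‖²_HS ≤ (Nℓ)² · Σ (‖∂₀Φ‖²_HS + ‖∂₁Φ‖²_HS)` for `N ≥ 2` — the twisted torus has a tree-level gap
`≥ (4/(Nℓ))²` on `su(N)` (`16/N² ≤ 4 sin²(π/N)`). [cite: GarciaperezGonzalezarroyoOkawa2014, §3] -/
theorem twistedTorus_poincare_sixteen (hN : 2 ≤ N) (hAu : A ∈ Matrix.unitaryGroup (Fin N) ℂ)
    (hBu : B ∈ Matrix.unitaryGroup (Fin N) ℂ) (hω : IsPrimitiveRoot ω N) (hAB : A * B = ω • (B * A)) {ℓ : ℕ}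
    {Φ : ℕ → ℕ → Matrix (Fin N) (Fin N) ℂ} (h0 : ∀ x y, Φ (x + ℓ) y = A * Φ x y * Aᴴ)
    (h1 : ∀ x y, Φ x (y + ℓ) = B * Φ x y * Bᴴ) (htr : ∀ x y, (Φ x y).trace = 0) :
    16 * ∑ x ∈ range ℓ, ∑ y ∈ range ℓ, (((Φ x y)ᴴ * Φ x y).trace).re ≤
      ((N : ℝ) * ℓ) ^ 2 * ∑ x ∈ range ℓ, ∑ y ∈ range ℓ,
        ((((Φ (x + 1) y - Φ x y)ᴴ * (Φ (x + 1) y - Φ x y)).trace).re +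
          (((Φ x (y + 1) - Φ x y)ᴴ * (Φ x (y + 1) - Φ x y)).trace).re) := by
  have hmass : 0 ≤ ∑ x ∈ range ℓ, ∑ y ∈ range ℓ, (((Φ x y)ᴴ * Φ x y).trace).re :=
    Finset.sum_nonneg fun x _ => Finset.sum_nonneg fun y _ => re_trace_conjTranspose_mul_self_nonneg _
  have hNpos : (0 : ℝ) < (N : ℝ) ^ 2 := by positivity
  have h16 := sixteen_div_sq_le_four_mul_sin_sq (N := N) hN
  have hP := twistedTorus_poincare hAu hBu hω hAB h0 h1 htr
  -- `16 Σ ≤ N² · 4 sin²(π/N) Σ ≤ N² ℓ² Σ[…]`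
  have h16' : 16 ≤ (N : ℝ) ^ 2 * (4 * Real.sin (Real.pi / N) ^ 2) := by
    rw [div_le_iff₀ hNpos] at h16
    linarith
  calc 16 * ∑ x ∈ range ℓ, ∑ y ∈ range ℓ, (((Φ x y)ᴴ * Φ x y).trace).re
      ≤ (N : ℝ) ^ 2 * (4 * Real.sin (Real.pi / N) ^ 2) *
          ∑ x ∈ range ℓ, ∑ y ∈ range ℓ, (((Φ x y)ᴴ * Φ x y).trace).re :=
        mul_le_mul_of_nonneg_right h16' hmass
    _ ≤ (N : ℝ) ^ 2 * ((ℓ : ℝ) ^ 2 * ∑ x ∈ range ℓ, ∑ y ∈ range ℓ,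
          ((((Φ (x + 1) y - Φ x y)ᴴ * (Φ (x + 1) y - Φ x y)).trace).re +
            (((Φ x (y + 1) - Φ x y)ᴴ * (Φ x (y + 1) - Φ x y)).trace).re)) := by
        rw [mul_assoc]
        exact mul_le_mul_of_nonneg_left hP hNpos.le
    _ = ((N : ℝ) * ℓ) ^ 2 * ∑ x ∈ range ℓ, ∑ y ∈ range ℓ,
          ((((Φ (x + 1) y - Φ x y)ᴴ * (Φ (x + 1) y - Φ x y)).trace).re +
            (((Φ x (y + 1) - Φ x y)ᴴ * (Φ x (y + 1) - Φ x y)).trace).re) := by ring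

end TwoD

/-! ## §4 The sharp constant `4 sin²(π/(Nℓ))`: Bloch–Fourier decomposition in the 't Hooft basis -/

section Sharp

variable [NeZero N] {A B : Matrix (Fin N) (Fin N) ℂ} {ω : ℂ}

/-- **One colour-momentum component** (García Pérez–González-Arroyo–Okawa 2014 §3: in the twisted box the component of the
adjoint field along `Γ̂(p)` carries «momentum quantized in units of `2π/(N̂ l_μ)` … excluding those with `m_μ = 0 (mod L) ∀μ`»).
For a primitive `N`-th root `ω`, a label `(a, b) ≠ (0, 0)` in `(ℤ/N)²` (read in `Fin N × Fin N`), and a scalar field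
`g : ℕ² → ℂ` with the twisted periodicity of the `(a, b)` component, `g(x+ℓ, y) = ω^b g(x,y)`, `g(x, y+ℓ) = (ω^a)⁻¹ g(x,y)`:
`4 sin²(π/(Nℓ)) · Σ_{x,y<ℓ} |g(x,y)|² ≤ Σ_{x,y<ℓ} (|g(x+1,y) − g(x,y)|² + |g(x,y+1) − g(x,y)|²)` — the allowed lattice momenta are
`2π(N n_μ + r_μ)/(Nℓ)` with `(r₀, r₁) = (b, −a) ≢ (0, 0) mod N`, the smallest of which has `4 Σ_μ sin²(p_μ/2) ≥ 4 sin²(π/(Nℓ))`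
(the periodic discrete Wirtinger inequality on `ℤ/(Nℓ)`, `bloch_poincare_2d`). [cite: GarciaperezGonzalezarroyoOkawa2014, §3]
[cite: GonzalezarroyoAltes1988, §2] -/
theorem colourMomentum_poincare_sharp (hω : IsPrimitiveRoot ω N) {a b : Fin N} (hab : (a, b) ≠ (0, 0)) {ℓ : ℕ}
    {g : ℕ → ℕ → ℂ} (h0 : ∀ x y, g (x + ℓ) y = ω ^ (b : ℕ) * g x y)
    (h1 : ∀ x y, g x (y + ℓ) = (ω ^ (a : ℕ))⁻¹ * g x y) :
    4 * Real.sin (Real.pi / ((N : ℝ) * ℓ)) ^ 2 * ∑ x ∈ range ℓ, ∑ y ∈ range ℓ, ‖g x y‖ ^ 2 ≤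
      ∑ x ∈ range ℓ, ∑ y ∈ range ℓ, (‖g (x + 1) y - g x y‖ ^ 2 + ‖g x (y + 1) - g x y‖ ^ 2) := by
  have hpow : ∀ q : Fin N, (ω ^ (q : ℕ)) ^ N = 1 := fun q => by
    rw [← pow_mul, mul_comm, pow_mul, hω.pow_eq_one, one_pow]
  have hne : ∀ q : Fin N, q ≠ 0 → ω ^ (q : ℕ) ≠ 1 := fun q hq =>
    hω.pow_ne_one_of_pos_of_lt (fun h => hq (Fin.ext h)) q.2
  have hβ : ((ω ^ (a : ℕ))⁻¹) ^ N = 1 := by rw [inv_pow, hpow, inv_one]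
  have hαβ : ω ^ (b : ℕ) ≠ 1 ∨ (ω ^ (a : ℕ))⁻¹ ≠ 1 := by
    by_cases hb : b = 0
    · have ha : a ≠ 0 := fun ha => hab (Prod.ext ha hb)
      exact Or.inr (by rw [Ne, inv_eq_one]; exact hne a ha)
    · exact Or.inl (hne b hb)
  exact Literature.Analysis.Fourier.bloch_poincare_2d (hpow b) hβ hαβ h0 h1

/-- ★★★ **Sharp Poincaré inequality for the adjoint Laplacian of the `ℓ × ℓ` torus with twist-eating boundary conditions.**
For a unitary Weyl pair `A B = ω·B A` (`ω` a primitive `N`-th root of unity) and an adjoint field `Φ : ℕ² → M_N(ℂ)` which is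
twisted-periodic, `Φ(x+ℓ, y) = A Φ(x,y) Aᴴ`, `Φ(x, y+ℓ) = B Φ(x,y) Bᴴ`, and TRACELESS:
`4 sin²(π/(Nℓ)) · Σ_{x,y<ℓ} ‖Φ(x,y)‖²_HS ≤ Σ_{x,y<ℓ} (‖Φ(x+1,y) − Φ(x,y)‖²_HS + ‖Φ(x,y+1) − Φ(x,y)‖²_HS)`.
Equivalently: on `su(N)`-valued fields the twisted adjoint nearest-neighbour Laplacian of the box is bounded below by
`4 sin²(π/(Nℓ)) = |1 − e^{2πi/(Nℓ)}|²`, the square of the smallest twisted lattice momentum («momentum quantized in units of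
`2π/(N̂ l_μ)`», all colour momenta `(a,b) ≠ (0,0) mod N`; González-Arroyo–Korthals Altes: the spectrum in a small twisted box
starts at `|p| = 2π/(N L)`), uniform in nothing else; the constant is attained.  Proof: expand `Φ(x,y) = Σ_{(a,b)} c_{ab}(x,y) A^aB^b`
in the 't Hooft basis (`TwistEaterIrreducibility` §5); the transition functions act diagonally, `c_{ab}(x+ℓ,y) = ω^b c_{ab}(x,y)`,
`c_{ab}(x,y+ℓ) = ω^{−a} c_{ab}(x,y)`; Hilbert–Schmidt orthogonality makes both sides `N Σ_{(a,b)}` of the scalar forms;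
`c_{00} ≡ 0` by tracelessness; and `colourMomentum_poincare_sharp` componentwise.
[cite: GarciaperezGonzalezarroyoOkawa2014, §3] [cite: GonzalezarroyoAltes1988, §2] [cite: Gonzalezarroyo1998, §4.3 Thm 1] -/
theorem twistedTorus_poincare_sharp (hAu : A ∈ Matrix.unitaryGroup (Fin N) ℂ) (hBu : B ∈ Matrix.unitaryGroup (Fin N) ℂ)
    (hω : IsPrimitiveRoot ω N) (hAB : A * B = ω • (B * A)) {ℓ : ℕ} {Φ : ℕ → ℕ → Matrix (Fin N) (Fin N) ℂ}
    (h0 : ∀ x y, Φ (x + ℓ) y = A * Φ x y * Aᴴ) (h1 : ∀ x y, Φ x (y + ℓ) = B * Φ x y * Bᴴ)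
    (htr : ∀ x y, (Φ x y).trace = 0) :
    4 * Real.sin (Real.pi / ((N : ℝ) * ℓ)) ^ 2 * ∑ x ∈ range ℓ, ∑ y ∈ range ℓ, (((Φ x y)ᴴ * Φ x y).trace).re ≤
      ∑ x ∈ range ℓ, ∑ y ∈ range ℓ,
        ((((Φ (x + 1) y - Φ x y)ᴴ * (Φ (x + 1) y - Φ x y)).trace).re +
          (((Φ x (y + 1) - Φ x y)ᴴ * (Φ x (y + 1) - Φ x y)).trace).re) := by
  classical
  have hA : IsUnit A := ⟨⟨A, star A, hAu.2, hAu.1⟩, rfl⟩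
  have hB : IsUnit B := ⟨⟨B, star B, hBu.2, hBu.1⟩, rfl⟩
  have hN0 : N ≠ 0 := NeZero.ne N
  have hω0 : ∀ a : ℕ, ω ^ a ≠ 0 := fun a => pow_ne_zero _ (hω.ne_zero hN0)
  -- the 't Hooft basis `e_p = A^a B^b` and its coordinate functional
  set e : Fin N × Fin N → Matrix (Fin N) (Fin N) ℂ := fun p => A ^ (p.1 : ℕ) * B ^ (p.2 : ℕ) with he
  have hli : LinearIndependent ℂ e := linearIndependent_pow_mul_pow hA hB hω hAB
  haveI : Nonempty (Fin N × Fin N) := ⟨(0, 0)⟩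
  have hcard : Fintype.card (Fin N × Fin N) = Module.finrank ℂ (Matrix (Fin N) (Fin N) ℂ) := by
    rw [Fintype.card_prod, Fintype.card_fin, Module.finrank_matrix, Fintype.card_fin, Module.finrank_self, mul_one]
  let bs : Module.Basis (Fin N × Fin N) ℂ (Matrix (Fin N) (Fin N) ℂ) := basisOfLinearIndependentOfCardEqFinrank hli hcard
  have hbs : ⇑bs = e := coe_basisOfLinearIndependentOfCardEqFinrank hli hcard
  have hexp : ∀ X : Matrix (Fin N) (Fin N) ℂ, X = ∑ p, bs.equivFun X p • e p := fun X => by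
    have h := bs.sum_equivFun X
    rw [hbs] at h
    exact h.symm
  have huniq : ∀ d : Fin N × Fin N → ℂ, bs.equivFun (∑ p, d p • e p) = d := fun d => by
    have h : bs.equivFun.symm d = ∑ p, d p • e p := by rw [Module.Basis.equivFun_symm_apply, hbs]
    rw [← h, LinearEquiv.apply_symm_apply]
  -- coordinates `c x y (a,b)` of the field (kept opaque)
  obtain ⟨c, hc⟩ : ∃ c : ℕ → ℕ → Fin N × Fin N → ℂ, ∀ x y, c x y = bs.equivFun (Φ x y) := ⟨_, fun _ _ => rfl⟩
  have hΦe : ∀ x y, Φ x y = ∑ p, c x y p • e p := fun x y => by rw [hc]; exact hexp (Φ x y)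
  -- (i) the transition functions act diagonally on the coordinates (colour momentum)
  have hcA : ∀ x y, c (x + ℓ) y = fun q => ω ^ (q.2 : ℕ) * c x y q := by
    intro x y
    have h : Φ (x + ℓ) y = ∑ q, (ω ^ (q.2 : ℕ) * c x y q) • e q := by
      rw [h0, hΦe x y, Matrix.mul_sum, Matrix.sum_mul]
      refine Finset.sum_congr rfl fun q _ => ?_
      rw [Matrix.mul_smul, Matrix.smul_mul, he, mul_pow_mul_pow_mul_conjTranspose hAB hAu.2, smul_smul]
      congr 1
      ring
    rw [hc, h, huniq]
  have hcB : ∀ x y, c x (y + ℓ) = fun q => (ω ^ (q.1 : ℕ))⁻¹ * c x y q := by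
    intro x y
    have h : Φ x (y + ℓ) = ∑ q, ((ω ^ (q.1 : ℕ))⁻¹ * c x y q) • e q := by
      rw [h1, hΦe x y, Matrix.mul_sum, Matrix.sum_mul]
      refine Finset.sum_congr rfl fun q _ => ?_
      rw [Matrix.mul_smul, Matrix.smul_mul, he, conj_pow_mul_pow_eq_smul hAB hBu.2 hω0, smul_smul]
      congr 1
      ring
    rw [hc, h, huniq]
  -- (ii) tracelessness kills the flux-free component `(0,0)`
  have hc00 : ∀ x y, c x y (0, 0) = 0 := by
    intro x y
    have h := congrArg Matrix.trace (hΦe x y)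
    rw [htr, Matrix.trace_sum] at h
    simp only [Matrix.trace_smul, smul_eq_mul, he, trace_pow_mul_pow hA hB hω hAB, mul_ite, mul_zero,
      Finset.sum_ite_eq', Finset.mem_univ, if_true] at h
    exact (mul_eq_zero.1 h.symm).resolve_right (Nat.cast_ne_zero.2 hN0)
  -- (iii) Hilbert–Schmidt energies in coordinates (orthogonality of the basis)
  have hnorm : ∀ d : Fin N × Fin N → ℂ,
      (((∑ p, d p • e p)ᴴ * (∑ p, d p • e p)).trace).re = (N : ℝ) * ∑ p, ‖d p‖ ^ 2 := by
    intro d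
    rw [he, trace_conjTranspose_sum_smul_pow_mul_pow hAu hBu hω hAB d]
    simp only [Complex.mul_re, Complex.natCast_re, Complex.natCast_im, zero_mul, sub_zero, Complex.re_sum,
      Complex.conj_mul', ← Complex.ofReal_pow, Complex.ofReal_re]
  have hsub : ∀ d d' : Fin N × Fin N → ℂ,
      (∑ p, d p • e p) - (∑ p, d' p • e p) = ∑ p, (d p - d' p) • e p := fun d d' => by
    rw [← Finset.sum_sub_distrib]
    exact Finset.sum_congr rfl fun p _ => (sub_smul _ _ _).symm
  have hS : ∀ x y, (((Φ x y)ᴴ * Φ x y).trace).re = (N : ℝ) * ∑ p, ‖c x y p‖ ^ 2 := fun x y => by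
    rw [hΦe x y, hnorm]
  have hSx : ∀ x y, (((Φ (x + 1) y - Φ x y)ᴴ * (Φ (x + 1) y - Φ x y)).trace).re =
      (N : ℝ) * ∑ p, ‖c (x + 1) y p - c x y p‖ ^ 2 := fun x y => by
    rw [hΦe (x + 1) y, hΦe x y, hsub, hnorm]
  have hSy : ∀ x y, (((Φ x (y + 1) - Φ x y)ᴴ * (Φ x (y + 1) - Φ x y)).trace).re =
      (N : ℝ) * ∑ p, ‖c x (y + 1) p - c x y p‖ ^ 2 := fun x y => by
    rw [hΦe x (y + 1), hΦe x y, hsub, hnorm]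
  -- (iv) componentwise sharp inequality
  have key : ∀ p : Fin N × Fin N,
      4 * Real.sin (Real.pi / ((N : ℝ) * ℓ)) ^ 2 * ∑ x ∈ range ℓ, ∑ y ∈ range ℓ, ‖c x y p‖ ^ 2 ≤
        ∑ x ∈ range ℓ, ∑ y ∈ range ℓ, (‖c (x + 1) y p - c x y p‖ ^ 2 + ‖c x (y + 1) p - c x y p‖ ^ 2) := by
    rintro ⟨a, b⟩
    by_cases hab : (a, b) = ((0 : Fin N), (0 : Fin N))
    · have hz : ∀ x y, c x y (a, b) = 0 := fun x y => by rw [hab]; exact hc00 x y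
      simp [hz]
    · exact colourMomentum_poincare_sharp hω hab (fun x y => congrFun (hcA x y) (a, b))
        (fun x y => congrFun (hcB x y) (a, b))
  -- (v) assemble: both sides are `N Σ_p` of the componentwise forms
  have comm3 : ∀ f : ℕ → ℕ → Fin N × Fin N → ℝ,
      ∑ x ∈ range ℓ, ∑ y ∈ range ℓ, ∑ p, f x y p = ∑ p, ∑ x ∈ range ℓ, ∑ y ∈ range ℓ, f x y p := fun f =>
    (Finset.sum_congr rfl fun x _ => Finset.sum_comm).trans Finset.sum_comm
  calc 4 * Real.sin (Real.pi / ((N : ℝ) * ℓ)) ^ 2 * ∑ x ∈ range ℓ, ∑ y ∈ range ℓ, (((Φ x y)ᴴ * Φ x y).trace).re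
      = 4 * Real.sin (Real.pi / ((N : ℝ) * ℓ)) ^ 2 *
          ∑ x ∈ range ℓ, ∑ y ∈ range ℓ, ((N : ℝ) * ∑ p, ‖c x y p‖ ^ 2) := by simp_rw [hS]
    _ = (N : ℝ) * ∑ p, (4 * Real.sin (Real.pi / ((N : ℝ) * ℓ)) ^ 2 * ∑ x ∈ range ℓ, ∑ y ∈ range ℓ, ‖c x y p‖ ^ 2) := by
        simp_rw [← Finset.mul_sum]
        rw [comm3]
        ring
    _ ≤ (N : ℝ) * ∑ p, ∑ x ∈ range ℓ, ∑ y ∈ range ℓ,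
          (‖c (x + 1) y p - c x y p‖ ^ 2 + ‖c x (y + 1) p - c x y p‖ ^ 2) :=
        mul_le_mul_of_nonneg_left (Finset.sum_le_sum fun p _ => key p) (Nat.cast_nonneg N)
    _ = ∑ x ∈ range ℓ, ∑ y ∈ range ℓ,
          ((N : ℝ) * ∑ p, ‖c (x + 1) y p - c x y p‖ ^ 2 + (N : ℝ) * ∑ p, ‖c x (y + 1) p - c x y p‖ ^ 2) := by
        simp_rw [← mul_add, ← Finset.sum_add_distrib]
        simp_rw [← Finset.mul_sum]
        rw [comm3]
    _ = ∑ x ∈ range ℓ, ∑ y ∈ range ℓ,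
          ((((Φ (x + 1) y - Φ x y)ᴴ * (Φ (x + 1) y - Φ x y)).trace).re +
            (((Φ x (y + 1) - Φ x y)ᴴ * (Φ x (y + 1) - Φ x y)).trace).re) := by simp_rw [hSx, hSy]

/-- **The twisted tube `ℓ × ℓ × L₂ × L₃` (uniform in `L₂, L₃`).**  For an adjoint field `Φ(x₀, x₁, x₂, x₃)` on a four-index box
which is twist-eating periodic in the two transverse directions, `Φ(x₀+ℓ, x₁, ·) = A Φ Aᴴ`, `Φ(x₀, x₁+ℓ, ·) = B Φ Bᴴ`
(unitary Weyl pair, `ω` primitive), and traceless — with NO assumption in the directions `x₂, x₃` (periodic, open, anything) —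
the transverse part of the nearest-neighbour Dirichlet form already dominates the mass over the whole box:
`4 sin²(π/(Nℓ)) · Σ_{x₂<L₂, x₃<L₃} Σ_{x₀,x₁<ℓ} S(Φ) ≤ Σ_{x₂<L₂, x₃<L₃} Σ_{x₀,x₁<ℓ} [S(∂₀Φ) + S(∂₁Φ)]`, `S(X) = Re tr(XᴴX)` —
the tree-level gap `4 sin²(π/(Nℓ))` of the twisted tube is UNIFORM in the longitudinal sizes `L₂, L₃` («the twist … naturally
provides an infrared cut-off», every mode of the tube is massive at tree level).  Slice by slice from `twistedTorus_poincare_sharp`.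
[cite: GarciaperezGonzalezarroyoOkawa2014, §3] [cite: GonzalezarroyoAltes1988, §2] -/
theorem twistedTube_poincare_sharp (hAu : A ∈ Matrix.unitaryGroup (Fin N) ℂ) (hBu : B ∈ Matrix.unitaryGroup (Fin N) ℂ)
    (hω : IsPrimitiveRoot ω N) (hAB : A * B = ω • (B * A)) {ℓ L₂ L₃ : ℕ}
    {Φ : ℕ → ℕ → ℕ → ℕ → Matrix (Fin N) (Fin N) ℂ}
    (h0 : ∀ x y u v, Φ (x + ℓ) y u v = A * Φ x y u v * Aᴴ) (h1 : ∀ x y u v, Φ x (y + ℓ) u v = B * Φ x y u v * Bᴴ)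
    (htr : ∀ x y u v, (Φ x y u v).trace = 0) :
    4 * Real.sin (Real.pi / ((N : ℝ) * ℓ)) ^ 2 *
        ∑ u ∈ range L₂, ∑ v ∈ range L₃, ∑ x ∈ range ℓ, ∑ y ∈ range ℓ, (((Φ x y u v)ᴴ * Φ x y u v).trace).re ≤
      ∑ u ∈ range L₂, ∑ v ∈ range L₃, ∑ x ∈ range ℓ, ∑ y ∈ range ℓ,
        ((((Φ (x + 1) y u v - Φ x y u v)ᴴ * (Φ (x + 1) y u v - Φ x y u v)).trace).re +
          (((Φ x (y + 1) u v - Φ x y u v)ᴴ * (Φ x (y + 1) u v - Φ x y u v)).trace).re) := by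
  rw [Finset.mul_sum]
  refine Finset.sum_le_sum fun u _ => ?_
  rw [Finset.mul_sum]
  refine Finset.sum_le_sum fun v _ => ?_
  exact twistedTorus_poincare_sharp (Φ := fun x y => Φ x y u v) hAu hBu hω hAB (fun x y => h0 x y u v)
    (fun x y => h1 x y u v) (fun x y => htr x y u v)

/-- … and a fortiori with the full four-direction Dirichlet form on the right (the longitudinal differences only add non-negative
terms): `4 sin²(π/(Nℓ)) · Σ S(Φ) ≤ Σ [S(∂₀Φ) + S(∂₁Φ) + S(∂₂Φ) + S(∂₃Φ)]` over the box `ℓ × ℓ × L₂ × L₃`, for every `L₂, L₃`.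
[cite: GarciaperezGonzalezarroyoOkawa2014, §3] [cite: GonzalezarroyoAltes1988, §2] -/
theorem twistedTube_poincare_sharp_four (hAu : A ∈ Matrix.unitaryGroup (Fin N) ℂ)
    (hBu : B ∈ Matrix.unitaryGroup (Fin N) ℂ) (hω : IsPrimitiveRoot ω N) (hAB : A * B = ω • (B * A)) {ℓ L₂ L₃ : ℕ}
    {Φ : ℕ → ℕ → ℕ → ℕ → Matrix (Fin N) (Fin N) ℂ}
    (h0 : ∀ x y u v, Φ (x + ℓ) y u v = A * Φ x y u v * Aᴴ) (h1 : ∀ x y u v, Φ x (y + ℓ) u v = B * Φ x y u v * Bᴴ)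
    (htr : ∀ x y u v, (Φ x y u v).trace = 0) :
    4 * Real.sin (Real.pi / ((N : ℝ) * ℓ)) ^ 2 *
        ∑ u ∈ range L₂, ∑ v ∈ range L₃, ∑ x ∈ range ℓ, ∑ y ∈ range ℓ, (((Φ x y u v)ᴴ * Φ x y u v).trace).re ≤
      ∑ u ∈ range L₂, ∑ v ∈ range L₃, ∑ x ∈ range ℓ, ∑ y ∈ range ℓ,
        ((((Φ (x + 1) y u v - Φ x y u v)ᴴ * (Φ (x + 1) y u v - Φ x y u v)).trace).re +
          (((Φ x (y + 1) u v - Φ x y u v)ᴴ * (Φ x (y + 1) u v - Φ x y u v)).trace).re +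
          (((Φ x y (u + 1) v - Φ x y u v)ᴴ * (Φ x y (u + 1) v - Φ x y u v)).trace).re +
          (((Φ x y u (v + 1) - Φ x y u v)ᴴ * (Φ x y u (v + 1) - Φ x y u v)).trace).re) := by
  refine (twistedTube_poincare_sharp hAu hBu hω hAB h0 h1 htr).trans
    (Finset.sum_le_sum fun u _ => Finset.sum_le_sum fun v _ => Finset.sum_le_sum fun x _ =>
      Finset.sum_le_sum fun y _ => ?_)
  have h2 := re_trace_conjTranspose_mul_self_nonneg (Φ x y (u + 1) v - Φ x y u v)
  have h3 := re_trace_conjTranspose_mul_self_nonneg (Φ x y u (v + 1) - Φ x y u v)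
  linarith

end Sharp

end Literature.MathematicalPhysics.QuantumLattice
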